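import Literature.IUT.LogVolume.Corollary22Legendre
import Literature.NumberTheory.DiophantineGeometry.GenEllRemarks44
import Literature.NumberTheory.DiophantineGeometry.GenEllTorsionFieldBaseChange
import Literature.NumberTheory.EllipticCurves.DivisionFieldDegreeProofs
import Literature.NumberTheory.EllipticCurves.AdditiveReductionRamifiedTorsionProofs
import Literature.NumberTheory.EllipticCurves.GaloisActionProofs
import Mathlib.FieldTheory.Normal.Closure
import Mathlib.FieldTheory.KrullTopology
import HarnessLib

/-!
# The `15`-torsion coordinates of the Legendre curve: Galois-theoretic bookkeeping

Mochizuki, *Inter-universal Teichmüller theory IV*, RIMS manuscript (Apr. 2020; = PRIMS **57** (2021)),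
Thm. 1.10, p. 22 / Cor. 2.2 (ii), p. 42: the field `F := F_tpd(√−1, E_{F_tpd}[3·5])`. This proof-only file
collects the classical lemmas (Silverman, *AEC*, VIII.§1: `Gal(K̄/K)` acts on `E(K̄)` through the coordinates;
`K(E[m])/K` is Galois) used by `Corollary22ThetaFieldExists.lean` to construct a field satisfying
`Cor22.IsThetaField`: adjoining a finite Galois-stable set of `K̄` gives a Galois extension whose degree
divides the index of any subgroup fixing the set; coordinates of points under the Galois action; `15`-torsion
is `3`-torsion plus `5`-torsion; a torsion point of `E(K̄)` with coordinates in `F` descends to `E(F)`; the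
`15`-torsion coordinate set of `E_F` read on the base change of `E_{F_tpd}`. Theorems only; classical; TAKES NO
SIDE on [IUTchIII] Cor. 3.12.
-/

noncomputable section

open scoped Classical

namespace Literature.IUT.LogVolume

namespace Cor22

open NumberField IsDedekindDomain Literature.NumberTheory.DiophantineGeometry.GenEll
open Literature.NumberTheory.EllipticCurves WeierstrassCurve IntermediateField

/-! ## Generic: adjoining a finite Galois-stable set -/

section Adjoin

variable {K : Type} [Field K]

/-- An element of `Gal(K̄/K)` fixing a set `S ⊆ K̄` pointwise fixes `K(S)`. [cite: SilvermanAEC2009, VIII.§1] -/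
theorem mem_fixingSubgroup_adjoin_of_forall_eq {S : Set (AlgebraicClosure K)}
    {σ : AlgebraicClosure K ≃ₐ[K] AlgebraicClosure K} (hσ : ∀ s ∈ S, σ s = s) :
    σ ∈ (adjoin K S).fixingSubgroup := by
  rw [IntermediateField.mem_fixingSubgroup_iff]
  intro x hx
  induction hx using adjoin_induction with
  | mem x hx => exact hσ x hx
  | algebraMap x => exact σ.commutes x
  | add x y _ _ hx hy => rw [map_add, hx, hy]
  | inv x _ hx => rw [map_inv₀, hx]
  | mul x y _ _ hx hy => rw [map_mul, hx, hy]

/-- Conversely an element of the fixing subgroup of `K(S)` fixes `S` pointwise. [cite: SilvermanAEC2009, VIII.§1] -/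
theorem forall_eq_of_mem_fixingSubgroup_adjoin {S : Set (AlgebraicClosure K)}
    {σ : AlgebraicClosure K ≃ₐ[K] AlgebraicClosure K} (hσ : σ ∈ (adjoin K S).fixingSubgroup) :
    ∀ s ∈ S, σ s = s := by
  rw [IntermediateField.mem_fixingSubgroup_iff] at hσ
  exact fun s hs => hσ s (subset_adjoin K S hs)

/-- `K(S)/K` is Galois for a finite Galois-stable set `S ⊆ K̄` (normal: every `σ ∈ Gal(K̄/K)` maps
`K(S) = K(σ S)` into itself; separable: characteristic `0`); the shape of "`K(E[m])/K` is Galois", Silverman *AEC* VIII.§1. [cite: SilvermanAEC2009, VIII.§1] -/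
theorem isGalois_adjoin_of_stable [NumberField K] {S : Set (AlgebraicClosure K)}
    (hS : ∀ σ : AlgebraicClosure K ≃ₐ[K] AlgebraicClosure K, ∀ s ∈ S, σ s ∈ S) :
    IsGalois K (adjoin K S) := by
  haveI : Normal K (adjoin K S) := by
    rw [normal_iff_forall_map_le']
    intro σ
    rw [adjoin_map]
    exact adjoin.mono _ _ _ (by rintro _ ⟨s, hs, rfl⟩; exact hS σ s hs)
  exact ⟨⟩

/-- `[K(S) : K]` divides the index of any subgroup of `Gal(K̄/K)` fixing `S` pointwise (Krull:
`[K(S) : K] = [Gal(K̄/K) : Gal(K̄/K(S))]`). [cite: SilvermanAEC2009, VIII.§1] -/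
theorem finrank_adjoin_dvd_index [NumberField K] {S : Set (AlgebraicClosure K)}
    (H : Subgroup (Field.absoluteGaloisGroup K)) (hH : ∀ σ ∈ H, ∀ s ∈ S, σ • s = s) :
    Module.finrank K (adjoin K S) ∣ H.index := by
  rw [IntermediateField.finrank_eq_fixingSubgroup_index]
  refine Subgroup.index_dvd_of_le fun σ hσ => ?_
  exact mem_fixingSubgroup_adjoin_of_forall_eq (σ := Field.absoluteGaloisGroup.toAlgEquiv K σ)
    fun s hs => hH σ hσ s hs

end Adjoin

/-! ## The `15`-torsion coordinates of the Legendre curve and their Galois theory -/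

section Torsion

open Field

variable (P : NFPoint)

/-- Galois acts on a point by acting on its coordinates: `coords(σ • T) = σ(coords(T))`
(Silverman *AEC* VIII.§1: `P^σ = (σ x, σ y)`). [cite: SilvermanAEC2009, VIII.§1] -/
theorem pointCoords_smul (σ : absoluteGaloisGroup P.F) (T : geomPoints P.legendreCurve) :
    pointCoords (σ • T) = (fun z : AlgebraicClosure P.F => σ • z) '' pointCoords T := by
  rcases T with _ | ⟨x, y, h⟩
  · show pointCoords (Affine.Point.zero : geomPoints P.legendreCurve) =
      (fun z : AlgebraicClosure P.F => σ • z) '' pointCoords (Affine.Point.zero : geomPoints P.legendreCurve)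
    simp [pointCoords]
  · show pointCoords (Affine.Point.map (absoluteGaloisGroup.toAlgEquiv P.F σ :
        AlgebraicClosure P.F →ₐ[P.F] AlgebraicClosure P.F) (Affine.Point.some x y h)) = _
    rw [Affine.Point.map_some]
    simp only [pointCoords, Set.image_pair]
    rfl

/-- A point all of whose coordinates are fixed by `σ` is fixed by `σ`. [cite: SilvermanAEC2009, VIII.§1] -/
theorem smul_eq_of_forall_coords (σ : absoluteGaloisGroup P.F)
    (T : geomPoints P.legendreCurve) (h : ∀ z ∈ pointCoords T, σ • z = z) : σ • T = T := by
  rcases T with _ | ⟨x, y, hxy⟩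
  · exact smul_zero σ
  · show Affine.Point.map (absoluteGaloisGroup.toAlgEquiv P.F σ :
        AlgebraicClosure P.F →ₐ[P.F] AlgebraicClosure P.F) (Affine.Point.some x y hxy) = _
    rw [Affine.Point.map_some]
    have hx : σ • x = x := h x (by simp [pointCoords])
    have hy : σ • y = y := h y (by simp [pointCoords])
    have hx' : (absoluteGaloisGroup.toAlgEquiv P.F σ : AlgebraicClosure P.F →ₐ[P.F]
        AlgebraicClosure P.F) x = x := hx
    have hy' : (absoluteGaloisGroup.toAlgEquiv P.F σ : AlgebraicClosure P.F →ₐ[P.F]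
        AlgebraicClosure P.F) y = y := hy
    simp only [hx', hy']

/-- A point fixed by `σ` has its coordinates fixed by `σ`. [cite: SilvermanAEC2009, VIII.§1] -/
theorem forall_coords_of_smul_eq (σ : absoluteGaloisGroup P.F)
    (T : geomPoints P.legendreCurve) (h : σ • T = T) : ∀ z ∈ pointCoords T, σ • z = z := by
  intro z hz
  rcases T with _ | ⟨x, y, hxy⟩
  · simp [pointCoords] at hz
  · have h' : Affine.Point.map (absoluteGaloisGroup.toAlgEquiv P.F σ :
        AlgebraicClosure P.F →ₐ[P.F] AlgebraicClosure P.F) (Affine.Point.some x y hxy) =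
        Affine.Point.some x y hxy := h
    rw [Affine.Point.map_some] at h'
    obtain ⟨hx, hy⟩ := Affine.Point.some.inj h'
    simp only [pointCoords, Set.mem_insert_iff, Set.mem_singleton_iff] at hz
    rcases hz with rfl | rfl
    · exact hx
    · exact hy

end Torsion

/-! ## The construction -/

section Construction

open Field

variable (P : NFPoint)

/-- The coordinate set of a point is finite (it has at most two elements). [cite: SilvermanAEC2009, VIII.§1] -/
theorem pointCoords_finite {F : Type} [Field F] {W : WeierstrassCurve F} (T : W.toAffine.Point) :
    (pointCoords T).Finite := by
  rcases T with _ | ⟨x, y, h⟩ <;> simp [pointCoords]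

/-- A `15`-torsion point is fixed by every `σ` fixing the `3`-torsion and the `5`-torsion pointwise
(`T = 10·T − 9·T`, `3·(10·T) = 0`, `5·(9·T) = 0`; `E[15] = E[3] ⊕ E[5]`, Silverman *AEC* III.§7). [cite: SilvermanAEC2009, III.§7] -/
theorem smul_eq_of_fifteen {F : Type} [Field F] {W : WeierstrassCurve F} (σ : absoluteGaloisGroup F)
    (h3 : ∀ Q : geomTorsion W ((3 : ℕ) : ℤ), σ • Q = Q) (h5 : ∀ Q : geomTorsion W ((5 : ℕ) : ℤ), σ • Q = Q)
    (T : geomPoints W) (hT : (15 : ℤ) • T = 0) : σ • T = T := by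
  have h10 : (10 : ℤ) • T ∈ geomTorsion W ((3 : ℕ) : ℤ) := by
    show (10 : ℤ) • T ∈ AddSubgroup.torsionBy (geomPoints W) _
    rw [AddSubgroup.torsionBy, Submodule.mem_toAddSubgroup, Submodule.mem_torsionBy_iff]
    show ((3 : ℕ) : ℤ) • (10 : ℤ) • T = 0
    rw [smul_smul, show (((3 : ℕ) : ℤ) * 10 : ℤ) = 2 * 15 by norm_num, mul_smul, hT, smul_zero]
  have h9 : (9 : ℤ) • T ∈ geomTorsion W ((5 : ℕ) : ℤ) := by
    show (9 : ℤ) • T ∈ AddSubgroup.torsionBy (geomPoints W) _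
    rw [AddSubgroup.torsionBy, Submodule.mem_toAddSubgroup, Submodule.mem_torsionBy_iff]
    show ((5 : ℕ) : ℤ) • (9 : ℤ) • T = 0
    rw [smul_smul, show (((5 : ℕ) : ℤ) * 9 : ℤ) = 3 * 15 by norm_num, mul_smul, hT, smul_zero]
  have e10 : σ • ((10 : ℤ) • T) = (10 : ℤ) • T := by
    have := congrArg Subtype.val (h3 ⟨_, h10⟩)
    rwa [AddSubgroup.torsionBy.coe_smul] at this
  have e9 : σ • ((9 : ℤ) • T) = (9 : ℤ) • T := by
    have := congrArg Subtype.val (h5 ⟨_, h9⟩)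
    rwa [AddSubgroup.torsionBy.coe_smul] at this
  have hdec : T = (10 : ℤ) • T - (9 : ℤ) • T := by rw [← sub_smul]; norm_num
  rw [hdec, smul_sub, e10, e9]

/-- **Descent of a torsion point with coordinates in `F`**: if `(a, b) ∈ E(K̄)` has coordinates in the
intermediate field `F` and `n·(a, b) = O`, then `(a, b)` is an `F`-point of `E ⊗ F` with `n·(a, b) = O` there
(the map `E(F) → E(K̄)` is an injective homomorphism, Silverman *AEC* VIII.§1). [cite: SilvermanAEC2009, VIII.§1] -/
theorem exists_torsionPoint_baseChange {K : Type} [Field K] (W₀ : WeierstrassCurve K)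
    (F : IntermediateField K (AlgebraicClosure K)) [DecidableEq F] {a b : AlgebraicClosure K}
    (ha : a ∈ F) (hb : b ∈ F)
    (hab : (W₀.baseChange (AlgebraicClosure K)).toAffine.Nonsingular a b) {n : ℤ}
    (hn : n • Affine.Point.some a b hab = 0) :
    ∃ T : (W₀.baseChange F).toAffine.Point, n • T = 0 ∧
      (⟨a, ha⟩ : F) ∈ pointCoords T ∧ (⟨b, hb⟩ : F) ∈ pointCoords T := by
  have hinj : Function.Injective (F.val : F →ₐ[K] AlgebraicClosure K) := F.val.injective
  have hns : (W₀.baseChange F).toAffine.Nonsingular ⟨a, ha⟩ ⟨b, hb⟩ :=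
    (Affine.baseChange_nonsingular W₀.toAffine (f := (F.val : F →ₐ[K] AlgebraicClosure K)) hinj
      ⟨a, ha⟩ ⟨b, hb⟩).1 hab
  refine ⟨Affine.Point.some _ _ hns, ?_, by simp [pointCoords], by simp [pointCoords]⟩
  have hmap : Affine.Point.map (W' := W₀.toAffine) (F.val : F →ₐ[K] AlgebraicClosure K)
      (Affine.Point.some _ _ hns) = Affine.Point.some a b hab := rfl
  apply Affine.Point.map_injective (W' := W₀.toAffine) (f := (F.val : F →ₐ[K] AlgebraicClosure K))
  have h := map_zsmul (Affine.Point.map (W' := W₀.toAffine) (F.val : F →ₐ[K] AlgebraicClosure K)) n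
    (Affine.Point.some _ _ hns)
  rw [h, map_zero, hmap]
  exact hn

/-- The Legendre curve over `F ⊇ F_tpd` is the base change of the Legendre curve over `F_tpd`.
[claim: Mochizuki2012, status: disputed] -/
theorem thetaCurve_eq_map (F : Type) [Field F] [NumberField F] [Algebra P.F F] :
    thetaCurve P F = P.legendreCurve.map (algebraMap P.F F) := by
  ext <;> simp [WeierstrassCurve.map]

/-- The `15`-torsion coordinate set of `E_F` read on the base change of `E_{F_tpd}` (same curve).
[claim: Mochizuki2012, status: disputed] -/
theorem torsionCoords_eq (F : Type) [Field F] [NumberField F] [Algebra P.F F] :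
    torsionCoords P F = ⋃ T ∈ {T : (P.legendreCurve.baseChange F).toAffine.Point | (15 : ℤ) • T = 0},
      pointCoords T := by
  have h : thetaCurve P F = P.legendreCurve.baseChange F := thetaCurve_eq_map P F
  unfold torsionCoords
  rw [h]

end Construction

end Cor22

end Literature.IUT.LogVolume

end
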